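import Mathlib
import Literature.Computability.AlgebraicComplexity.AsymptoticSpectrum
import Literature.Computability.AlgebraicComplexity.SchoenhageTau
import Literature.Computability.AlgebraicComplexity.AlderStrassenProofs

-- (imports Literature only: the piece is copied verbatim below, so this file elaborates independently of the
-- route file's revision; the route decl `HesseHammingShells.<Piece>` unfolds to the local copy.)

/-!
# Birth skeleton for the support piece `PencilDominatesShells` (stmt-MatrixMultiplication-17615) — line "Alder + all-degree generic member + Vandermonde"

`PencilDominatesShells`: `∃ s⋆, ∀ N, ∀ m ≤ N, bR(H_m^{(N)}) ≤ (N+1)·bR(T_{s⋆}^{⊠N})` — one member of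
the Hesse pencil border-dominates every Hamming shell at every degree. THEOREM-GRADE; this file cuts
it into three genuine lemmas and kernel-checks the composition.

* `stub_allDegreeGenericMember` (M/L): some `s⋆` is border-generic in EVERY degree:
  `bR(T_s^{⊠N}) ≤ bR(T_{s⋆}^{⊠N})` for all `N, s`. Proof route: Alder's theorem, PROVED in tree
  (`alder_secantVariety_eq_setOf_algBorderRank_le_holds`, `AlderStrassenProofs.lean`), makes
  `{t : bR(t) ≤ r}` the zero set of polynomials; the entries of `T_s^{⊠N}` lie in `ℤ[s]`, so
  `E_{N,r} := {s : bR(T_s^{⊠N}) ≤ r}` is finite or `ℂ`; with `g_N := max_s bR(T_s^{⊠N})` (`≤ 27^N`),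
  `E_{N,g_N−1} ≠ ℂ` is finite, `⋃_N E_{N,g_N−1}` is countable and `ℂ` is not (`Cardinal.mk_complex`),
  and any `s⋆` outside has `bR(T_{s⋆}^{⊠N}) = g_N` for all `N`.
* `stub_vandermondeShells` (M): for `N+1` distinct nodes `σ_j`, every shell is a linear combination
  of the pencil powers, `H_m^{(N)} = Σ_j c_j • T_{σ_j}^{⊠N}` (the generating identity
  `T_s^{⊠N} = Σ_{m ≤ N} s^m H_m^{(N)}` = item `HessePowerExpansion`, proved by refuters on stmt-5161,
  inverted with `Matrix.vandermonde`, `Matrix.det_vandermonde ≠ 0`).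
* `stub_borderRankSubadditive` (M, Literature-level): `bR(Σ_j c_j • t_j) ≤ Σ_j bR(t_j)` for
  `algBorderRank` (concatenate approximate decompositions after equalising their orders with
  `IsApproxDecomposition.succ`; scalars via restriction, `algBorderRank_smul_le` pattern).
Composition `PencilDominatesShells_of` (kernel-checked; sorries only in the three stubs): nodes
`σ_j := j` (`j = 0..N`), subadditivity, each summand bounded by the generic member, `N+1` summands.
-/

set_option linter.dupNamespace false

namespace Summit.MatrixMultiplication.MatrixMultiplication.Cruxes.PencilDominatesShells.AlderVandermonde

open scoped BigOperators
open Literature.Computability.AlgebraicComplexity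

/-- The Hesse pencil member `T_s` (local abbreviation; unfolds to the route's inline lambda). -/
def hesse (s : ℂ) : Fin 3 → Fin 3 → Fin 3 → ℂ :=
  fun x y z : Fin 3 => if x + y + z = 0 then (if x = y then (1 : ℂ) else s) else 0

/-- The radius-`m` Hamming shell `H_m^{(N)}` of the `Z_3^N` addition table (route's inline lambda). -/
def shell (N m : ℕ) : (Fin N → Fin 3) → (Fin N → Fin 3) → (Fin N → Fin 3) → ℂ :=
  fun x y z : Fin N → Fin 3 => if (∀ i, x i + y i + z i = 0) ∧ (Finset.univ.filter (fun i => x i ≠ y i)).card = m then (1 : ℂ) else 0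

/-- The piece, verbatim (the route decl `HesseHammingShells.PencilDominatesShells` unfolds to this). -/
def PencilDominatesShells : Prop :=
  ∃ s : ℂ, ∀ N m : ℕ, m ≤ N → Literature.Computability.AlgebraicComplexity.algBorderRank (fun x y z : Fin N → Fin 3 => if (∀ i, x i + y i + z i = 0) ∧ (Finset.univ.filter (fun i => x i ≠ y i)).card = m then (1 : ℂ) else 0) ≤ (N + 1) * Literature.Computability.AlgebraicComplexity.algBorderRank (Literature.Computability.AlgebraicComplexity.kroneckerPow (fun x y z : Fin 3 => if x + y + z = 0 then (if x = y then (1 : ℂ) else s) else 0) N)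

/-- STUB 1 (theorem-grade, size M/L): an all-degree border-generic member exists
(Alder's theorem in tree + `ℂ` uncountable). -/
theorem stub_allDegreeGenericMember :
    ∃ s₀ : ℂ, ∀ (N : ℕ) (s : ℂ),
      algBorderRank (kroneckerPow (hesse s) N) ≤ algBorderRank (kroneckerPow (hesse s₀) N) := by
  sorry

/-- STUB 2 (size M): Vandermonde interpolation of the shells through `N+1` distinct pencil powers. -/
theorem stub_vandermondeShells :
    ∀ (N m : ℕ), m ≤ N → ∀ σ : Fin (N + 1) → ℂ, Function.Injective σ →
      ∃ c : Fin (N + 1) → ℂ, shell N m = ∑ j, c j • kroneckerPow (hesse (σ j)) N := by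
  sorry

/-- STUB 3 (size M, Literature-level lemma): subadditivity of `algBorderRank` under linear
combinations (stated on the shell format). -/
theorem stub_borderRankSubadditive :
    ∀ (N n : ℕ) (c : Fin n → ℂ) (t : Fin n → (Fin N → Fin 3) → (Fin N → Fin 3) → (Fin N → Fin 3) → ℂ),
      algBorderRank (∑ j, c j • t j) ≤ ∑ j, algBorderRank (t j) := by
  sorry

/-- COMPOSITION (kernel-checked): generic member + interpolation + subadditivity give the piece. -/
theorem PencilDominatesShells_of
    (h₁ : ∃ s₀ : ℂ, ∀ (N : ℕ) (s : ℂ),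
      algBorderRank (kroneckerPow (hesse s) N) ≤ algBorderRank (kroneckerPow (hesse s₀) N))
    (h₂ : ∀ (N m : ℕ), m ≤ N → ∀ σ : Fin (N + 1) → ℂ, Function.Injective σ →
      ∃ c : Fin (N + 1) → ℂ, shell N m = ∑ j, c j • kroneckerPow (hesse (σ j)) N)
    (h₃ : ∀ (N n : ℕ) (c : Fin n → ℂ) (t : Fin n → (Fin N → Fin 3) → (Fin N → Fin 3) → (Fin N → Fin 3) → ℂ),
      algBorderRank (∑ j, c j • t j) ≤ ∑ j, algBorderRank (t j)) :
    PencilDominatesShells := by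
  obtain ⟨s₀, hs₀⟩ := h₁
  refine ⟨s₀, fun N m hm => ?_⟩
  -- nodes `0, 1, …, N`
  have hσ : Function.Injective (fun j : Fin (N + 1) => ((j : ℕ) : ℂ)) := by
    intro i j h
    have h' : ((i : ℕ) : ℂ) = ((j : ℕ) : ℂ) := h
    exact Fin.ext (by exact_mod_cast h')
  obtain ⟨c, hc⟩ := h₂ N m hm (fun j : Fin (N + 1) => ((j : ℕ) : ℂ)) hσ
  change algBorderRank (shell N m) ≤ (N + 1) * algBorderRank (kroneckerPow (hesse s₀) N)
  rw [hc]
  refine (h₃ N (N + 1) c _).trans ?_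
  calc ∑ j : Fin (N + 1), algBorderRank (kroneckerPow (hesse (((j : ℕ) : ℂ))) N)
      ≤ ∑ _j : Fin (N + 1), algBorderRank (kroneckerPow (hesse s₀) N) :=
        Finset.sum_le_sum fun j _ => hs₀ N _
    _ = (N + 1) * algBorderRank (kroneckerPow (hesse s₀) N) := by
        rw [Finset.sum_const, Finset.card_univ, Fintype.card_fin, smul_eq_mul]

/-- The skeleton closes the piece from its stubs. -/
theorem PencilDominatesShells_of_stubs : PencilDominatesShells :=
  PencilDominatesShells_of stub_allDegreeGenericMember stub_vandermondeShells stub_borderRankSubadditive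

end Summit.MatrixMultiplication.MatrixMultiplication.Cruxes.PencilDominatesShells.AlderVandermonde
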